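import Mathlib
import Summits.ResolutionOfSingularities.ResolutionOfSingularities.Theorems.HomologicalConductorNoZenoSplitData
import Summits.ResolutionOfSingularities.ResolutionOfSingularities.Theorems.SyzygyFlatteningRankOneTerminationStageNormal
import Summits.ResolutionOfSingularities.ResolutionOfSingularities.Theorems.SyzygyFlatteningHigherRankTerminationNrmLocAt
import HarnessLib

/-!
# D2′ PART 4a: the relative split model `R[β] ⊆ K_g` and its normalisation

W4.4 (crux `NoZenoR`, stmt-ResolutionOfSingularities-19943), `stub_L1wCore` route (F1), descent
step (B2) of `L1W-PREP-v2.md` §2.1 (res-L0-w44-stub-2) — the CHART SIDE of `Sig.L1Core`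
(res-L0-w44-lead-1): after the germ `D` has been base-changed along `D → D[X]/(f)`
(`…NoZenoSplitData`), the chart ring `B = k[D ∪ C·x⁻¹]`, its normalisation `nrm B` and the local
rings `(nrm B)_𝔮` must be followed into the enlarged field `K_g := K[X]/(g)`, `g := f_K`.  Since
these rings are not local and `f` lives over various subrings, everything here is phrased for ONE
fixed polynomial `g ∈ K[X]` and a `k`-subalgebra `R ⊆ K` over which `g` has a model
`f ∈ R[X]` (`f.map (R → K) = g`):

* `liftHom R f g hg : R[X]/(f) →ₐ[k] K_g` (`root ↦ root`), injective for `f` monic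
  (`liftHom_injective`), its image the RELATIVE MODEL `liftModel R f g hg = R[β]`
  (`liftEquiv : R[X]/(f) ≃ₐ[k] R[β]`), which is the coefficient-free
  `adjoinBeta R g := k[R ∪ {β}] ⊆ K_g` (`liftModel_eq_adjoinBeta`);
* `R[β]` has `Frac = K_g` when `Frac R = K` (`isFractionRing_liftModel`), is essentially of
  finite type over `k` when `R` is (`essFiniteType_liftModel`), and is a NORMAL DOMAIN when `R` is
  normal with `Frac R = K` and `f'` is a unit modulo `f` (`isIntegrallyClosed_liftModel`, BC-N♯ —
  `g` irreducible over `K` gives `f` irreducible over `R` by Gauss); the unit condition ascends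
  along any `R → R'` (`isUnit_mk_derivative_map`), so it is inherited from the germ `D` where it
  comes from the separable reduction (`SplittingBase.isUnit_mk_derivative_of_separable_map`);
* **normalisation commutes with adjoining `β`**: `nrm (k[B ∪ {β}]) = k[nrm B ∪ {β}]`
  (`nrm_adjoinBeta_eq`) for `D ≤ B ⊆ K` with `Frac B = K` — the upstairs chart ring's
  normalisation is the base change of the downstairs one.

OURS (cell res-hironaka, chain W4.4); AI-written, weaker than expert review; nothing here is a
statement of the manuscript under review (Hironaka 2017); no Theses file is imported.
-/

noncomputable section

set_option linter.dupNamespace false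

open IsLocalRing Polynomial
open Summit.ResolutionOfSingularities.ResolutionOfSingularities.Theorems.NoZeno.Birth (nrm nrm_eq_nrm)
open Summit.ResolutionOfSingularities.ResolutionOfSingularities.Theorems.SyzygyFlattening
  (mem_nrm_iff self_le_nrm isIntegral_of_le isIntegrallyClosed_nrm)

namespace Summit.ResolutionOfSingularities.ResolutionOfSingularities.Theorems.NoZeno.SplittingBase

variable {k K : Type} [Field k] [Field K] [Algebra k K]

/-! ## The relative model `R[β]` -/

section LiftModel

variable (R : Subalgebra k K) (f : (↥R)[X]) (g : K[X]) (hg : f.map (algebraMap ↥R K) = g)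

include hg in
/-- The root of `g` in `K_g` is a root of the model `f`. [this work] -/
theorem eval₂_root_eq_zero_of_map_eq :
    f.eval₂ (algebraMap ↥R (AdjoinRoot g)) (AdjoinRoot.root g) = 0 := by
  rw [← aeval_def, ← aeval_map_algebraMap K (AdjoinRoot.root g) f, hg, AdjoinRoot.aeval_eq,
    AdjoinRoot.mk_self]

/-- `R[X]/(f) →ₐ[k] K_g`, `root ↦ root`, `R ⊆ K ⊆ K_g`. [this work] -/
def liftHom : AdjoinRoot f →ₐ[k] AdjoinRoot g :=
  (AdjoinRoot.liftAlgHom f (Algebra.ofId ↥R (AdjoinRoot g)) (AdjoinRoot.root g)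
    (eval₂_root_eq_zero_of_map_eq R f g hg)).restrictScalars k

/-- `liftHom` on constants. [this work] -/
theorem liftHom_of (r : ↥R) :
    liftHom R f g hg (AdjoinRoot.of f r) = algebraMap K (AdjoinRoot g) (r : K) := by
  rw [liftHom, AlgHom.restrictScalars_apply, AdjoinRoot.liftAlgHom_of]
  exact IsScalarTower.algebraMap_apply ↥R K _ r

/-- `liftHom` on the root. [this work] -/
theorem liftHom_root : liftHom R f g hg (AdjoinRoot.root f) = AdjoinRoot.root g := by
  rw [liftHom, AlgHom.restrictScalars_apply, AdjoinRoot.liftAlgHom_root]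

/-- `liftHom` on classes of polynomials. [this work] -/
theorem liftHom_mk (p : (↥R)[X]) :
    liftHom R f g hg (AdjoinRoot.mk f p) = AdjoinRoot.mk g (p.map (algebraMap ↥R K)) := by
  rw [liftHom, AlgHom.restrictScalars_apply, AdjoinRoot.liftAlgHom_mk, ← AdjoinRoot.aeval_eq,
    aeval_map_algebraMap, aeval_def]
  rfl

include hg in
/-- `liftHom` is injective for `f` monic. [this work] -/
theorem liftHom_injective (hf : f.Monic) : Function.Injective (liftHom R f g hg) := by
  rw [injective_iff_map_eq_zero]
  intro x hx
  induction x using AdjoinRoot.induction_on with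
  | ih p =>
    rw [liftHom_mk, AdjoinRoot.mk_eq_zero, ← hg,
      Polynomial.map_dvd_map _ (FaithfulSMul.algebraMap_injective ↥R K) hf] at hx
    exact AdjoinRoot.mk_eq_zero.mpr hx

/-- **The relative model** `R[β] ⊆ K_g`. [this work] -/
def liftModel : Subalgebra k (AdjoinRoot g) := (liftHom R f g hg).range

/-- `R[X]/(f) ≃ₐ[k] R[β]` (`f` monic). [this work] -/
def liftEquiv (hf : f.Monic) : AdjoinRoot f ≃ₐ[k] ↥(liftModel R f g hg) :=
  AlgEquiv.ofInjective (liftHom R f g hg) (liftHom_injective R f g hg hf)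

/-- Underlying element of `liftEquiv`. [this work] -/
theorem coe_liftEquiv (hf : f.Monic) (x : AdjoinRoot f) :
    ((liftEquiv R f g hg hf x : ↥(liftModel R f g hg)) : AdjoinRoot g) = liftHom R f g hg x := rfl

/-- Elements of `R` lie in `R[β]`. [this work] -/
theorem algebraMap_mem_liftModel {x : K} (hx : x ∈ R) :
    algebraMap K (AdjoinRoot g) x ∈ liftModel R f g hg :=
  ⟨AdjoinRoot.of f ⟨x, hx⟩, liftHom_of R f g hg ⟨x, hx⟩⟩

/-- `β ∈ R[β]`. [this work] -/
theorem root_mem_liftModel : AdjoinRoot.root g ∈ liftModel R f g hg :=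
  ⟨AdjoinRoot.root f, liftHom_root R f g hg⟩

/-- **The coefficient-free spelling `k[R ∪ {β}] ⊆ K_g`** of the relative model. [this work] -/
def adjoinBeta (R : Subalgebra k K) (g : K[X]) : Subalgebra k (AdjoinRoot g) :=
  Algebra.adjoin k (algebraMap K (AdjoinRoot g) '' (R : Set K) ∪ {AdjoinRoot.root g})

/-- `adjoinBeta` is monotone in `R`. [this work] -/
theorem adjoinBeta_mono {R R' : Subalgebra k K} (h : R ≤ R') (g : K[X]) :
    adjoinBeta R g ≤ adjoinBeta R' g :=
  Algebra.adjoin_mono (Set.union_subset_union_left _ (Set.image_mono fun _ hx => h hx))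

/-- `R[β] = k[R ∪ {β}]`. [this work] -/
theorem liftModel_eq_adjoinBeta : liftModel R f g hg = adjoinBeta R g := by
  apply le_antisymm
  · intro y hy
    rw [liftModel, AlgHom.mem_range] at hy
    obtain ⟨x, rfl⟩ := hy
    induction x using AdjoinRoot.induction_on with
    | ih p =>
      rw [liftHom, AlgHom.restrictScalars_apply, AdjoinRoot.liftAlgHom_mk, eval₂_eq_sum_range]
      have hβ : AdjoinRoot.root g ∈ adjoinBeta R g := Algebra.subset_adjoin (Or.inr rfl)
      refine sum_mem fun i _ => mul_mem ?_ (pow_mem hβ _)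
      change algebraMap ↥R (AdjoinRoot g) (p.coeff i) ∈ adjoinBeta R g
      rw [IsScalarTower.algebraMap_apply ↥R K (AdjoinRoot g)]
      exact Algebra.subset_adjoin (Or.inl ⟨_, (p.coeff i).2, rfl⟩)
  · refine Algebra.adjoin_le (Set.union_subset ?_ ?_)
    · rintro _ ⟨x, hx, rfl⟩
      exact algebraMap_mem_liftModel R f g hg hx
    · rintro _ rfl
      exact root_mem_liftModel R f g hg

/-- The germ model of `…NoZenoSplitData` is the relative model over the germ:
`splitModel D f = liftModel D f f_K rfl`. [this work] -/
theorem splitModel_eq_liftModel (D : Subalgebra k K) (f : (↥D)[X]) :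
    splitModel D f = liftModel D f (f.map (algebraMap ↥D K)) rfl := rfl

/-- `k[k[S] ∪ {β}] = k[S ∪ {β}]`: adjoining `β` to a generated subalgebra. [this work] -/
theorem adjoinBeta_adjoin (S : Set K) (g : K[X]) :
    adjoinBeta (Algebra.adjoin k S) g = Algebra.adjoin k (algebraMap K (AdjoinRoot g) '' S ∪ {AdjoinRoot.root g}) := by
  apply le_antisymm
  · refine Algebra.adjoin_le (Set.union_subset ?_ fun y hy => Algebra.subset_adjoin (Or.inr hy))
    have h : algebraMap K (AdjoinRoot g) '' (Algebra.adjoin k S : Set K) =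
        ((Algebra.adjoin k S).map (IsScalarTower.toAlgHom k K (AdjoinRoot g)) : Set (AdjoinRoot g)) := by
      rw [Subalgebra.coe_map]; rfl
    rw [h, AlgHom.map_adjoin, SetLike.coe_subset_coe]
    exact Algebra.adjoin_mono Set.subset_union_left
  · exact Algebra.adjoin_mono (Set.union_subset_union_left _ (Set.image_mono Algebra.subset_adjoin))

/-- **`Frac (R[β]) = K_g`** when `Frac R = K`. [this work] -/
theorem isFractionRing_liftModel [IsFractionRing ↥R K] (hf : f.Monic) [Fact (Irreducible g)] :
    IsFractionRing ↥(liftModel R f g hg) (AdjoinRoot g) := by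
  refine IsFractionRing.of_field _ _ fun z => ?_
  obtain ⟨q, rfl⟩ := AdjoinRoot.mk_surjective z
  obtain ⟨b, hbM, hb⟩ := IsLocalization.integerNormalization_spec (nonZeroDivisors ↥R) q
  have hb0 : ((b : ↥R) : K) ≠ 0 := fun h => nonZeroDivisors.ne_zero hbM (Subtype.ext h)
  refine ⟨liftEquiv R f g hg hf (AdjoinRoot.mk f (IsLocalization.integerNormalization (nonZeroDivisors ↥R) q)),
    liftEquiv R f g hg hf (AdjoinRoot.of f b), ?_⟩
  simp only [Subalgebra.algebraMap_apply]
  rw [coe_liftEquiv, coe_liftEquiv, liftHom_mk, liftHom_of]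
  have hb' : (IsLocalization.integerNormalization (nonZeroDivisors ↥R) q).map (algebraMap ↥R K) =
      C ((b : ↥R) : K) * q := by
    rw [hb, Algebra.smul_def, Polynomial.algebraMap_apply]
    rfl
  rw [hb', map_mul, AdjoinRoot.mk_C, mul_comm, ← AdjoinRoot.algebraMap_eq,
    mul_div_cancel_right₀ _ ((map_ne_zero_iff _ (algebraMap K _).injective).mpr hb0)]

/-- **`R[β]` is essentially of finite type over `k`** when `R` is. [this work] -/
theorem essFiniteType_liftModel [Algebra.EssFiniteType k ↥R] (hf : f.Monic) :
    Algebra.EssFiniteType k ↥(liftModel R f g hg) := by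
  haveI : Algebra.EssFiniteType ↥R (AdjoinRoot f) := inferInstance
  haveI : Algebra.EssFiniteType k (AdjoinRoot f) := Algebra.EssFiniteType.comp k ↥R (AdjoinRoot f)
  exact Algebra.EssFiniteType.of_surjective (liftEquiv R f g hg hf).toAlgHom (liftEquiv R f g hg hf).surjective

include hg in
/-- Gauss: `g` irreducible over `K = Frac R`, `R` normal ⇒ the model `f` is irreducible over `R`.
[folklore] -/
theorem irreducible_of_map_eq [IsFractionRing ↥R K] [IsIntegrallyClosed ↥R] (hf : f.Monic)
    [hirr : Fact (Irreducible g)] : Irreducible f :=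
  (hf.irreducible_iff_irreducible_map_fraction_map (K := K)).mpr (hg ▸ hirr.out)

/-- **`R[β]` is a normal domain** for `R` normal with `Frac R = K` and `f'` a unit modulo `f`
(BC-N♯). [this work] -/
theorem isIntegrallyClosed_liftModel [IsFractionRing ↥R K] [IsIntegrallyClosed ↥R] (hf : f.Monic)
    [Fact (Irreducible g)] (hu : IsUnit (AdjoinRoot.mk f (derivative f))) :
    IsIntegrallyClosed ↥(liftModel R f g hg) :=
  (isIntegrallyClosed_of_equiv_adjoinRoot hf (irreducible_of_map_eq R f g hg hf) hu
    (liftEquiv R f g hg hf).toRingEquiv).2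

/-- **`R[β]` is integrally closed IN `K_g`** (same hypotheses). [this work] -/
theorem mem_liftModel_of_isIntegral [IsFractionRing ↥R K] [IsIntegrallyClosed ↥R] (hf : f.Monic)
    [Fact (Irreducible g)] (hu : IsUnit (AdjoinRoot.mk f (derivative f))) {y : AdjoinRoot g}
    (hy : IsIntegral ↥(liftModel R f g hg) y) : y ∈ liftModel R f g hg := by
  haveI := isFractionRing_liftModel R f g hg hf
  haveI := isIntegrallyClosed_liftModel R f g hg hf hu
  obtain ⟨z, hz⟩ := (isIntegrallyClosed_iff (AdjoinRoot g)).mp ‹_› hy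
  rw [← hz]
  exact z.2

/-- **The unit condition ascends**: if `f'` is a unit modulo `f` over `R`, so it is over any
`R`-algebra `R'`. [folklore] -/
theorem isUnit_mk_derivative_map {A A' : Type*} [CommRing A] [CommRing A'] (φ : A →+* A')
    {p : A[X]} (hu : IsUnit (AdjoinRoot.mk p (derivative p))) :
    IsUnit (AdjoinRoot.mk (p.map φ) (derivative (p.map φ))) := by
  let ψ : AdjoinRoot p →+* AdjoinRoot (p.map φ) :=
    AdjoinRoot.lift ((AdjoinRoot.of (p.map φ)).comp φ) (AdjoinRoot.root (p.map φ))
      (by rw [← eval₂_map]; exact AdjoinRoot.eval₂_root _)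
  have hψ : ψ (AdjoinRoot.mk p (derivative p)) = AdjoinRoot.mk (p.map φ) (derivative (p.map φ)) := by
    rw [AdjoinRoot.lift_mk, ← eval₂_map, ← AdjoinRoot.algebraMap_eq, ← aeval_def, AdjoinRoot.aeval_eq,
      ← derivative_map]
  exact hψ ▸ hu.map ψ

end LiftModel

/-! ## Normalisation commutes with adjoining `β` -/

section Nrm

variable (D B : Subalgebra k K) (hDB : D ≤ B) (f : (↥D)[X]) (g : K[X])
  (hg : f.map (algebraMap ↥D K) = g)

/-- `g` has a model over any `R ⊇ D`: `f` read in `R[X]`. [this work] -/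
theorem map_map_inclusion {R : Subalgebra k K} (hDR : D ≤ R) :
    (f.map (Subalgebra.inclusion hDR).toRingHom).map (algebraMap ↥R K) = f.map (algebraMap ↥D K) := by
  rw [Polynomial.map_map]
  rfl

include hDB hg in
/-- **`nrm (k[B ∪ {β}]) = k[nrm B ∪ {β}]`**: for `D ≤ B ⊆ K` with `Frac B = K`, `f ∈ D[X]` monic
with `f'` a unit modulo `f` and `f_K = g` irreducible, the normalisation (inside `K_g`) of the
upstairs chart ring `B[β]` is the upstairs ring of the normalisation. [this work] -/
theorem nrm_adjoinBeta_eq [IsFractionRing ↥B K] (hf : f.Monic) [Fact (Irreducible g)]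
    (hu : IsUnit (AdjoinRoot.mk f (derivative f))) :
    nrm (adjoinBeta B g) = adjoinBeta (nrm B) g := by
  rw [nrm_eq_nrm, nrm_eq_nrm]
  -- the normal model `(nrm B)[β]`, written with coefficients `f` read over `nrm B`
  have hDN : D ≤ SyzygyFlattening.nrm B := hDB.trans (self_le_nrm B)
  set fN : (↥(SyzygyFlattening.nrm B))[X] := f.map (Subalgebra.inclusion hDN).toRingHom with hfN
  have hgN : fN.map (algebraMap _ K) = g := (map_map_inclusion D f hDN).trans hg
  have hfNm : fN.Monic := hf.map _
  have huN : IsUnit (AdjoinRoot.mk fN (derivative fN)) := isUnit_mk_derivative_map _ hu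
  haveI : IsFractionRing ↥(SyzygyFlattening.nrm B) K :=
    Literature.AlgebraicGeometry.Resolution.isFractionRing_subalgebra_of_le B _ (self_le_nrm B)
  haveI : IsIntegrallyClosed ↥(SyzygyFlattening.nrm B) := isIntegrallyClosed_nrm B
  have hN : liftModel _ fN g hgN = adjoinBeta (SyzygyFlattening.nrm B) g := liftModel_eq_adjoinBeta _ fN g hgN
  apply le_antisymm
  · -- `⊆`: an element integral over `B[β]` is integral over the normal domain `(nrm B)[β] ⊇ B[β]`
    refine Algebra.adjoin_le fun y hy => ?_
    rw [← hN]
    refine mem_liftModel_of_isIntegral _ fN g hgN hfNm huN ?_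
    have hle : adjoinBeta B g ≤ liftModel _ fN g hgN := hN ▸ adjoinBeta_mono (self_le_nrm B) g
    exact hy.map_of_comp_eq (Subalgebra.inclusion hle).toRingHom (RingHom.id _) (RingHom.ext fun _ => rfl)
  · -- `⊇`: `nrm B` and `β` are integral over `B ⊆ B[β]`
    have hint : ∀ y ∈ algebraMap K (AdjoinRoot g) '' (SyzygyFlattening.nrm B : Set K) ∪ {AdjoinRoot.root g},
        IsIntegral ↥(adjoinBeta B g) y := by
      have hBle : ∀ b : ↥B, algebraMap K (AdjoinRoot g) (b : K) ∈ adjoinBeta B g :=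
        fun b => Algebra.subset_adjoin (Or.inl ⟨_, b.2, rfl⟩)
      -- `B → B[β]`, compatible with `K → K_g`
      let ι : ↥B →+* ↥(adjoinBeta B g) :=
        ((algebraMap K (AdjoinRoot g)).comp B.val.toRingHom).codRestrict _ hBle
      have hι : (algebraMap ↥(adjoinBeta B g) (AdjoinRoot g)).comp ι =
          (algebraMap K (AdjoinRoot g)).comp (algebraMap ↥B K) := RingHom.ext fun _ => rfl
      rintro y (⟨x, hx, rfl⟩ | rfl)
      · exact ((mem_nrm_iff B).mp hx).map_of_comp_eq ι (algebraMap K (AdjoinRoot g)) hι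
      · have hβ : IsIntegral ↥B (AdjoinRoot.root g) := by
          refine ⟨f.map (Subalgebra.inclusion hDB).toRingHom, hf.map _, ?_⟩
          have hcomp : (algebraMap ↥B (AdjoinRoot g)).comp (Subalgebra.inclusion hDB).toRingHom =
              algebraMap ↥D (AdjoinRoot g) := RingHom.ext fun _ => rfl
          rw [eval₂_map, hcomp]
          exact eval₂_root_eq_zero_of_map_eq D f g hg
        exact hβ.map_of_comp_eq ι (RingHom.id _) (by rw [hι]; rfl)
    exact Algebra.adjoin_le fun y hy => Algebra.subset_adjoin (hint y hy)

end Nrm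

end Summit.ResolutionOfSingularities.ResolutionOfSingularities.Theorems.NoZeno.SplittingBase

end
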